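import Literature.MathematicalPhysics.QuantumFieldTheory.CentreDominatedWilsonLoops
import Literature.MathematicalPhysics.QuantumFieldTheory.ConstructiveQFTWave0WilsonLoopRPProofs
import HarnessLib

/-!
# Centre domination of Polyakov-loop correlators: the static quark–antiquark free energy at
# temperature `1/L` of a compact gauge theory with a central involution `z`, `ρ(z) = -1`, is
# bounded by that of `ℤ₂` lattice gauge theory at the coupling `N β`

Statement-and-proof file (topic `Literature/MathematicalPhysics/QuantumFieldTheory`), everything
PROVED, no named facts, one definition (the Polyakov-pair observable), in the vocabulary of the
tree's torus Wilson theory (`ConstructiveQFTWave0`: `GaugeConfig`, `wilsonExpectation`,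
`lineHolonomy U j L x` = the Polyakov line of full length `L` wrapping the torus in direction `j`,
as in the tree's Tomboulis–Yaffe files) and of Fröhlich's centre decomposition
(`CentreDominatedWilsonLoops.lean`: `centreTwist`, `centreUnit`, `abs_wilsonExpectation_le_gksExpect_of_twist`).

## The result (finite-temperature companion of centre domination of Wilson loops)

Fröhlich 1979 / Mack–Petkova 1979 (as restated with proof by Grosse 1988 §4.2.4 (4.130)–(4.134);
tree: `abs_wilsonExpectation_wilsonLoop_le_centre`): `|⟨W_C⟩_{G,β}| ≤ ⟨W_C⟩_{ℤ₂,Nβ}` for rectangular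
Wilson loops. The argument («`χ(g_C) = χ(g̃_C) ∏_{b∈C} γ_b`», (4.133), for any closed curve `C`)
applies verbatim to the product of two POLYAKOV LOOPS — straight lines closed by the periodic boundary
condition — i.e. to the finite-temperature static quark–antiquark correlator of Tomboulis–Yaffe 1985
(2.8)–(2.10), `G(x - y) = ⟨tr ρ(P_j(x)) conj tr ρ(P_j(y))⟩ = e^{-F_{qq̄}(x-y)/T}`:

* `abs_wilsonExpectation_polyakovPairObs_le_centre` — for every compact `G` (Borel), continuous
  unitary `ρ : G →* M_N(ℂ)`, central involution `z`, `ρ(z) = -1`, `β ≥ 0`, torus `(ℤ/L)^d` with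
  `L ≥ 2`, direction `j`, base points `x, y`, and every complex `c` with `‖c‖ ≤ 1`:
  `|⟨Re(c · tr ρ(P_j(x)) · conj tr ρ(P_j(y)))/N²⟩_{G,ρ,β}| ≤ ⟨χ(P_j(x)) χ(P_j(y))⟩_{ℤ₂,Nβ}`;
* ★ `norm_polyakovCorrelator_le_centre` — optimising the phase `c`:
  `‖⟨tr ρ(P_j(x)) conj tr ρ(P_j(y))⟩_{G,ρ,β,L}‖ ≤ N² · ⟨χ(P_j(x)) χ(P_j(y))⟩_{ℤ₂,Nβ,L}`
  — the Polyakov-loop correlator of `G` at `β` is dominated by the `ℤ₂` Polyakov-loop correlator at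
  `Nβ`; in free-energy form `F^G_{qq̄}(x-y; β) ≥ F^{ℤ₂}_{qq̄}(x-y; Nβ) - 2T ln N`: **confinement of static
  quarks at temperature `T = 1/L` is inherited from the centre theory**;
* `su2_norm_polyakovCorrelator_le_z2` (`SU(2)`, fundamental, `-𝟙`, coupling `2β`),
  `specialUnitaryGroup_norm_polyakovCorrelator_le_z2_of_even` (`SU(N)`, `N` even, coupling `Nβ`).

## Mechanism

Under the central twist `U ↦ z^σ U` a line holonomy picks up the central factor
`centreUnit(∏_{b ∈ line} σ_b)` (`lineHolonomy_centreTwist`, from the tree's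
`lineHolonomy_mul_of_mem_center`), so `tr ρ(P(z^σU)) = χ(P(σ)) tr ρ(P(U))` with `χ = ±1`
(`trace_lineHolonomy_centreTwist`) and the observable `X_c = Re(c tr P_x conj tr P_y)/N²` transforms
by the link spin product over the odd support of the two lines (`polyakovPairObs_centreTwist`);
`|X_c| ≤ 1` for unitary `ρ` and `‖c‖ ≤ 1`. The tree's abstract centre-domination theorem
`abs_wilsonExpectation_le_gksExpect_of_twist` (Grosse (4.134)) bounds `|⟨X_c⟩|` by the homogeneous
`ℤ₂` expectation of that spin product, which `gksExpect_const_eq_wilsonExpectation_z2` identifies with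
the `ℤ₂` Polyakov-loop correlator. Finally `⟨X_c⟩ = Re(c ⟨tr P_x conj tr P_y⟩)/N²` (the correlator
is an integrable bounded measurable function: `EntryMeasurable` traces) and `c = conj E/‖E‖` gives the
norm.

## Status of the citation — HONEST LABEL

Printed for Wilson loops «for any closed curve `C`» (Grosse 1988 (4.133)–(4.134); Fröhlich 1979;
Mack–Petkova 1979 §2); the Polyakov-loop (finite-temperature) reading is the same formula for the
closed curves wrapping the torus and is labelled an elementary consequence — we have not located it
stated separately as a theorem (Borgs–Seiler 1983 treat finite-temperature confinement/deconfinement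
by other means). HONEST FRAMING: inequalities between finite-volume lattice expectations; in `d = 4`
the `ℤ₂` theory at `Nβ` deconfines at weak coupling, so the bound has content at strong coupling
only; nothing here bears on the mass gap, the continuum limit or the infrared problem; the
Yang–Mills mass gap (Clay) is NOT proved; the cell's route R4 closes only the conditional
finite-`𝕋⁴` rung `BalabanLadder.UV`.

## References

* H. Grosse, *Models in Statistical Physics and Quantum Field Theory* (Springer 1988), §4.2.4
  (4.129)–(4.134) (held: galaxy panama:432606285922348, pp. 84–85). [Grosse1988]
* J. Fröhlich, Phys. Lett. 83B (1979) 195–198. [Frohlich1979ZN] (not held; title-level)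
* G. Mack, V. B. Petkova, Ann. Phys. 123 (1979) 442–467, §2. [MackPetkova1979] (not held)
* E. T. Tomboulis, L. G. Yaffe, Comm. Math. Phys. 100 (1985) 313–341, §II (2.8)–(2.10).
  [TomboulisYaffe1985]
* C. Borgs, E. Seiler, Comm. Math. Phys. 91 (1983) 329–380. [BorgsSeiler1983]
-/

noncomputable section

open MeasureTheory Finset Complex
open scoped ComplexConjugate symmDiff
open Literature.Probability.LatticeModels Literature.MathematicalPhysics.QuantumLattice

namespace Literature.MathematicalPhysics.QuantumFieldTheory

/-! ### §1 Line holonomies under central twists -/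

section LineTwist

variable {d L N : ℕ} {G : Type*} [Group G]

/-- Line holonomies are functorial in the group: `P(φ ∘ σ) = φ(P(σ))` for a homomorphism `φ`.
[folklore] -/
private theorem lineHolonomy_map {H : Type*} [Group H] (φ : H →* G) (σ : GaugeConfig d L H)
    (k : Fin d) : ∀ (n : ℕ) (y : Site d L),
      lineHolonomy (fun e => φ (σ e)) k n y = φ (lineHolonomy σ k n y)
  | 0, _ => by simp [lineHolonomy]
  | n + 1, y => by
      show φ (σ (y, k)) * lineHolonomy (fun e => φ (σ e)) k n (y.shift k) =
        φ (σ (y, k) * lineHolonomy σ k n (y.shift k))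
      rw [lineHolonomy_map φ σ k n, map_mul]

/-- The values of `centreUnit z` are central when `z` is. [folklore] -/
private theorem centreUnit_mem_center' {z : G} (hzc : z ∈ Subgroup.center G) (hz2 : z * z = 1)
    (a : Multiplicative (ZMod 2)) : centreUnit z hz2 a ∈ Subgroup.center G := by
  show (if a = 1 then (1 : G) else z) ∈ Subgroup.center G
  split_ifs
  · exact one_mem _
  · exact hzc

/-- **Line holonomy under a central twist**: `P(z^σ U) = z^{σ_P} · P(U)` with `z^{σ_P} =
centreUnit(∏_{b ∈ P} σ_b)` (the path version of Grosse 1988 (4.133),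
`χ(g_C) = χ(g̃_C) ∏_{b∈C} γ_b`). [cite: Grosse1988, §4.2.4 eq. (4.133)] -/
theorem lineHolonomy_centreTwist {z : G} (hzc : z ∈ Subgroup.center G) (hz2 : z * z = 1)
    (σ : GaugeConfig d L (Multiplicative (ZMod 2))) (U : GaugeConfig d L G) (k : Fin d) (n : ℕ)
    (y : Site d L) :
    lineHolonomy (centreTwist z hz2 σ U) k n y =
      centreUnit z hz2 (lineHolonomy σ k n y) * lineHolonomy U k n y := by
  rw [centreTwist_eq_mul,
    (lineHolonomy_mul_of_mem_center _ U (fun e => centreUnit_mem_center' hzc hz2 (σ e)) k n y).2,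
    lineHolonomy_map (centreUnit z hz2) σ k n y]

variable (ρ : G →* Matrix (Fin N) (Fin N) ℂ)

/-- **The Polyakov line picks up the `ℤ₂` character of the twist**: for `ρ(z) = -1`,
`tr ρ(P(z^σ U)) = χ(P(σ)) · tr ρ(P(U))`, `χ = ±1` (Grosse 1988 (4.133)).
[cite: Grosse1988, §4.2.4 eq. (4.133)] -/
theorem trace_lineHolonomy_centreTwist {z : G} (hzc : z ∈ Subgroup.center G) (hz2 : z * z = 1)
    (hρz : ρ z = -1) (σ : GaugeConfig d L (Multiplicative (ZMod 2))) (U : GaugeConfig d L G)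
    (k : Fin d) (n : ℕ) (y : Site d L) :
    (ρ (lineHolonomy (centreTwist z hz2 σ U) k n y)).trace =
      ((z2Character (lineHolonomy σ k n y) : ℝ) : ℂ) * (ρ (lineHolonomy U k n y)).trace := by
  rw [lineHolonomy_centreTwist hzc hz2, map_mul, map_centreUnit ρ hz2 hρz, Matrix.smul_mul, one_mul,
    Matrix.trace_smul, smul_eq_mul]

end LineTwist

/-! ### §2 The Polyakov-pair observable and its twist covariance -/

section PolyakovPair

variable {d L N : ℕ} {G : Type*} [Group G] (ρ : G →* Matrix (Fin N) (Fin N) ℂ)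

/-- The **Polyakov-pair observable** with a phase `c`:
`X_c(U) = Re(c · tr ρ(P_j(x)) · conj tr ρ(P_j(y))) / N²`, `P_j(x) = lineHolonomy U j L x` the
Polyakov line through `x` in direction `j` (full length `L`, closed by periodicity) — the real parts
of the phases of Tomboulis–Yaffe's static quark–antiquark correlator (2.8),
`G(x - y) = ⟨tr P(x) conj tr P(y)⟩` (normalised by `N²`). [cite: TomboulisYaffe1985, §II eq. (2.8)] -/
def polyakovPairObs [NeZero L] (j : Fin d) (x y : Site d L) (c : ℂ) (U : GaugeConfig d L G) : ℝ :=
  (c * ((ρ (lineHolonomy U j L x)).trace * conj (ρ (lineHolonomy U j L y)).trace)).re / (N : ℝ) ^ 2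

/-- `‖tr M‖ ≤ N` for a unitary `N × N` matrix. [folklore] -/
private theorem norm_trace_le_of_mem_unitaryGroup {U : Matrix (Fin N) (Fin N) ℂ}
    (hU : U ∈ Matrix.unitaryGroup (Fin N) ℂ) : ‖U.trace‖ ≤ N := by
  calc ‖U.trace‖ = ‖∑ a, U a a‖ := rfl
    _ ≤ ∑ a, ‖U a a‖ := norm_sum_le _ _
    _ ≤ ∑ _a : Fin N, (1 : ℝ) := Finset.sum_le_sum fun a _ => entry_norm_bound_of_unitary hU a a
    _ = N := by simp

/-- `‖tr ρ(P_x) conj tr ρ(P_y)‖ ≤ N²` for unitary `ρ` (Tomboulis–Yaffe: `|G(x)| ≤ N²` with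
unnormalised traces). [cite: TomboulisYaffe1985, §II eq. (2.8)] -/
theorem norm_trace_mul_conj_trace_le [NeZero L] (hρu : ∀ g, ρ g ∈ Matrix.unitaryGroup (Fin N) ℂ)
    (j : Fin d) (x y : Site d L) (U : GaugeConfig d L G) :
    ‖(ρ (lineHolonomy U j L x)).trace * conj (ρ (lineHolonomy U j L y)).trace‖ ≤ (N : ℝ) ^ 2 := by
  rw [norm_mul, Complex.norm_conj, sq]
  exact mul_le_mul (norm_trace_le_of_mem_unitaryGroup (hρu _))
    (norm_trace_le_of_mem_unitaryGroup (hρu _)) (norm_nonneg _) (Nat.cast_nonneg _)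

/-- `|X_c| ≤ 1` for unitary `ρ` and `‖c‖ ≤ 1`. [cite: TomboulisYaffe1985, §II eq. (2.8)] -/
theorem abs_polyakovPairObs_le_one [NeZero L] (hρu : ∀ g, ρ g ∈ Matrix.unitaryGroup (Fin N) ℂ)
    (j : Fin d) (x y : Site d L) {c : ℂ} (hc : ‖c‖ ≤ 1) (U : GaugeConfig d L G) :
    |polyakovPairObs ρ j x y c U| ≤ 1 := by
  rw [polyakovPairObs]
  rcases Nat.eq_zero_or_pos N with hN | hN
  · subst hN
    simp
  · have hN2 : (0 : ℝ) < (N : ℝ) ^ 2 := by positivity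
    rw [abs_div, abs_of_pos hN2, div_le_one hN2]
    refine (Complex.abs_re_le_norm _).trans ?_
    rw [norm_mul]
    calc ‖c‖ * ‖(ρ (lineHolonomy U j L x)).trace * conj (ρ (lineHolonomy U j L y)).trace‖
        ≤ 1 * (N : ℝ) ^ 2 := mul_le_mul hc (norm_trace_mul_conj_trace_le ρ hρu j x y U)
          (norm_nonneg _) zero_le_one
      _ = (N : ℝ) ^ 2 := one_mul _

variable [DecidableEq (Edge d L)]

/-- A product of `±1` link spins along a list is the spin product over its odd support (`σ_b² = 1`;
the tree's `oddSupport`). [folklore] -/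
private theorem prod_map_spinAt_eq_spinProduct_oddSupport' (ω : SpinConfig (Edge d L)) :
    ∀ l : List (Edge d L), (l.map fun e => spinAt e ω).prod = spinProduct (oddSupport l) ω
  | [] => by simp [oddSupport, spinProduct]
  | a :: l => by
      rw [List.map_cons, List.prod_cons, prod_map_spinAt_eq_spinProduct_oddSupport' ω l, oddSupport,
        ← spinProduct_mul_eq_spinProduct_symmDiff]
      simp [spinProduct]

/-- The links of the two Polyakov lines, with multiplicity; their odd support is the link set `A`
over which the pair observable transforms. [folklore] -/
def polyakovPairOddEdges [NeZero L] (j : Fin d) (x y : Site d L) : Finset (Edge d L) :=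
  oddSupport (lineEdgeList j L x ++ lineEdgeList j L y)

/-- **The `ℤ₂` Polyakov-loop correlator is a link spin product**:
`χ(P_j(x)(σ)) χ(P_j(y)(σ)) = σ_A`, `A` the odd support of the links of the two lines
(Chatterjee 2020 (1.3), `W_γ = ∏_{e∈γ} σ_e`, for the two wrapping lines).
[cite: arXiv181109770, §1.1 (1.3)] -/
theorem z2Character_lineHolonomy_mul_eq_spinProduct [NeZero L]
    (σ : GaugeConfig d L (Multiplicative (ZMod 2))) (j : Fin d) (x y : Site d L) :
    z2Character (lineHolonomy σ j L x) * z2Character (lineHolonomy σ j L y) =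
      spinProduct (polyakovPairOddEdges j x y) (spinCfg σ) := by
  rw [z2Character_lineHolonomy, z2Character_lineHolonomy, polyakovPairOddEdges,
    ← prod_map_spinAt_eq_spinProduct_oddSupport', List.map_append, List.prod_append]
  simp only [spinAt_spinCfg]

/-- **Twist covariance of the Polyakov pair**: `X_c(z^σ U) = σ_A · X_c(U)` (both traces pick up
their real `ℤ₂` characters, `trace_lineHolonomy_centreTwist`; Grosse 1988 (4.133)).
[cite: Grosse1988, §4.2.4 eq. (4.133)] -/
theorem polyakovPairObs_centreTwist [NeZero L] {z : G} (hzc : z ∈ Subgroup.center G)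
    (hz2 : z * z = 1) (hρz : ρ z = -1) (j : Fin d) (x y : Site d L) (c : ℂ)
    (σ : GaugeConfig d L (Multiplicative (ZMod 2))) (U : GaugeConfig d L G) :
    polyakovPairObs ρ j x y c (centreTwist z hz2 σ U) =
      spinProduct (polyakovPairOddEdges j x y) (spinCfg σ) * polyakovPairObs ρ j x y c U := by
  rw [polyakovPairObs, polyakovPairObs, trace_lineHolonomy_centreTwist ρ hzc hz2 hρz,
    trace_lineHolonomy_centreTwist ρ hzc hz2 hρz, ← z2Character_lineHolonomy_mul_eq_spinProduct,
    map_mul, Complex.conj_ofReal]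
  set a : ℝ := z2Character (lineHolonomy σ j L x)
  set b : ℝ := z2Character (lineHolonomy σ j L y)
  set t₁ : ℂ := (ρ (lineHolonomy U j L x)).trace
  set t₂ : ℂ := (ρ (lineHolonomy U j L y)).trace
  have h : c * ((a : ℂ) * t₁ * ((b : ℂ) * conj t₂)) = ((a * b : ℝ) : ℂ) * (c * (t₁ * conj t₂)) := by
    push_cast; ring
  rw [h, Complex.re_ofReal_mul, mul_div_assoc]

end PolyakovPair

/-! ### §3 Centre domination of the Polyakov-loop correlator -/

section Domination

variable {d L N : ℕ} [NeZero L] {G : Type*} [Group G] [TopologicalSpace G] [IsTopologicalGroup G]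
  [CompactSpace G] [MeasurableSpace G] [BorelSpace G] (ρ : G →* Matrix (Fin N) (Fin N) ℂ)

/-- **Centre domination of the phased Polyakov pair.** Compact `G`, continuous unitary `ρ` on
`ℂ^N`, central involution `z` with `ρ(z) = -1`, `β ≥ 0`, torus side `L ≥ 2`, `‖c‖ ≤ 1`:
`|⟨Re(c tr P_x conj tr P_y)/N²⟩_{G,ρ,β}| ≤ ⟨χ(P_x)χ(P_y)⟩_{ℤ₂,Nβ}` — the abstract theorem
`abs_wilsonExpectation_le_gksExpect_of_twist` (Grosse 1988 (4.134)) applied to the twist-covariant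
observable `X_c` (`polyakovPairObs_centreTwist`), with the homogeneous `ℤ₂` link system identified
with the tree's `ℤ₂` torus Wilson theory (`gksExpect_const_eq_wilsonExpectation_z2`).
[cite: Grosse1988, §4.2.4 eqs. (4.133)–(4.134)] -/
theorem abs_wilsonExpectation_polyakovPairObs_le_centre [Fact (1 < L)] (hρ : Continuous ρ)
    (hρu : ∀ g, ρ g ∈ Matrix.unitaryGroup (Fin N) ℂ) {z : G} (hzc : z ∈ Subgroup.center G)
    (hz2 : z * z = 1) (hρz : ρ z = -1) {β : ℝ} (hβ : 0 ≤ β) (j : Fin d) (x y : Site d L) {c : ℂ}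
    (hc : ‖c‖ ≤ 1) :
    |wilsonExpectation ρ β (polyakovPairObs ρ j x y c)| ≤
      wilsonExpectation (L := L) z2Rep ((N : ℝ) * β)
        (fun σ => z2Character (lineHolonomy σ j L x) * z2Character (lineHolonomy σ j L y)) := by
  classical
  have h := abs_wilsonExpectation_le_gksExpect_of_twist ρ hρ hρu hzc hz2 hρz hβ
    (polyakovPairObs ρ j x y c) (polyakovPairOddEdges j x y)
    (fun U => abs_polyakovPairObs_le_one ρ hρu j x y hc U)
    (fun σ U => polyakovPairObs_centreTwist ρ hzc hz2 hρz j x y c σ U)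
  rw [gksExpect_const_eq_wilsonExpectation_z2] at h
  simpa only [← z2Character_lineHolonomy_mul_eq_spinProduct] using h

/-- The Polyakov-loop correlator `U ↦ tr ρ(P_x) conj tr ρ(P_y)` is integrable for the torus Wilson
state (bounded by `N²`, entry-measurable traces; continuous `ρ`). [folklore] -/
private theorem integrable_polyakovCorrelator (hρ : Continuous ρ)
    (hρu : ∀ g, ρ g ∈ Matrix.unitaryGroup (Fin N) ℂ) (β : ℝ) (j : Fin d) (x y : Site d L) :
    Integrable (fun U : GaugeConfig d L G =>
      (ρ (lineHolonomy U j L x)).trace * conj (ρ (lineHolonomy U j L y)).trace) (wilsonMeasure ρ β) := by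
  haveI := isProbabilityMeasure_wilsonMeasure (d := d) (L := L) ρ hρ β
  have htr : ∀ w : Site d L, Measurable fun U : GaugeConfig d L G => (ρ (lineHolonomy U j L w)).trace := by
    intro w
    have hE := WilsonLoopRP.entryMeasurable_lineHolonomy (d := d) (L := L) (τ := ρ) hρ j L w
    simp only [Matrix.trace, Matrix.diag_apply]
    exact Finset.measurable_sum _ fun k _ => hE k k
  have hmeas : Measurable fun U : GaugeConfig d L G =>
      (ρ (lineHolonomy U j L x)).trace * conj (ρ (lineHolonomy U j L y)).trace :=
    (htr x).mul (Complex.continuous_conj.measurable.comp (htr y))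
  exact ⟨hmeas.aestronglyMeasurable, .of_bounded (C := (N : ℝ) ^ 2)
    (ae_of_all _ fun U => norm_trace_mul_conj_trace_le ρ hρu j x y U)⟩

/-- The expectation of the phased pair observable is the phased real part of the correlator:
`⟨X_c⟩ = Re(c · ⟨tr P_x conj tr P_y⟩)/N²`. [folklore] -/
private theorem wilsonExpectation_polyakovPairObs (hρ : Continuous ρ)
    (hρu : ∀ g, ρ g ∈ Matrix.unitaryGroup (Fin N) ℂ) (β : ℝ) (j : Fin d) (x y : Site d L) (c : ℂ) :
    wilsonExpectation ρ β (polyakovPairObs ρ j x y c) =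
      (c * wilsonExpectation ρ β (fun U : GaugeConfig d L G =>
        (ρ (lineHolonomy U j L x)).trace * conj (ρ (lineHolonomy U j L y)).trace)).re / (N : ℝ) ^ 2 := by
  unfold wilsonExpectation polyakovPairObs
  rw [integral_div, ← integral_const_mul]
  congr 1
  have hint := (integrable_polyakovCorrelator ρ hρ hρu β j x y).const_mul c
  have h := integral_re hint
  simpa using h

/-- ★ **CENTRE DOMINATION OF THE POLYAKOV-LOOP CORRELATOR.** For every compact `G`, continuous
unitary `ρ : G →* M_N(ℂ)`, central involution `z` with `ρ(z) = -1`, `β ≥ 0`, torus `(ℤ/L)^d` with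
`L ≥ 2`, direction `j` and base points `x, y`:
`‖⟨tr ρ(P_j(x)) · conj tr ρ(P_j(y))⟩_{G,ρ,β,L}‖ ≤ N² · ⟨χ(P_j(x)) χ(P_j(y))⟩_{ℤ₂, Nβ, L}` —
Tomboulis–Yaffe's static quark–antiquark correlator `G(x-y) = e^{-F_{qq̄}/T}` ((2.8)) of the
`G`-theory at `β` is dominated by the `ℤ₂` Polyakov-loop correlator at `Nβ`: in free-energy form
`F^G_{qq̄}(x-y) ≥ F^{ℤ₂, Nβ}_{qq̄}(x-y) - 2T ln N`, i.e. CONFINEMENT OF STATIC QUARKS AT TEMPERATURE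
`T = 1/L` IS INHERITED FROM THE CENTRE THEORY (Grosse 1988 (4.133)–(4.134), «for any closed curve»,
here the two lines closed by periodicity). HONEST LABEL: finite-volume lattice expectations; in
`d = 4` the `ℤ₂` theory at `Nβ` deconfines at weak coupling, where the bound is merely structural.
[cite: Grosse1988, §4.2.4 eqs. (4.133)–(4.134)] [cite: TomboulisYaffe1985, §II eqs. (2.8)–(2.10)] -/
theorem norm_polyakovCorrelator_le_centre [Fact (1 < L)] (hρ : Continuous ρ)
    (hρu : ∀ g, ρ g ∈ Matrix.unitaryGroup (Fin N) ℂ) {z : G} (hzc : z ∈ Subgroup.center G)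
    (hz2 : z * z = 1) (hρz : ρ z = -1) {β : ℝ} (hβ : 0 ≤ β) (j : Fin d) (x y : Site d L) :
    ‖wilsonExpectation ρ β (fun U : GaugeConfig d L G =>
        (ρ (lineHolonomy U j L x)).trace * conj (ρ (lineHolonomy U j L y)).trace)‖ ≤
      (N : ℝ) ^ 2 * wilsonExpectation (L := L) z2Rep ((N : ℝ) * β)
        (fun σ => z2Character (lineHolonomy σ j L x) * z2Character (lineHolonomy σ j L y)) := by
  set E : ℂ := wilsonExpectation ρ β (fun U : GaugeConfig d L G =>
    (ρ (lineHolonomy U j L x)).trace * conj (ρ (lineHolonomy U j L y)).trace) with hE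
  set W : ℝ := wilsonExpectation (L := L) z2Rep ((N : ℝ) * β)
    (fun σ => z2Character (lineHolonomy σ j L x) * z2Character (lineHolonomy σ j L y)) with hW
  rcases Nat.eq_zero_or_pos N with hN | hN
  · -- `N = 0`: the traces vanish
    subst hN
    have h0 : E = 0 := by
      rw [hE]
      have : (fun U : GaugeConfig d L G => (ρ (lineHolonomy U j L x)).trace *
          conj (ρ (lineHolonomy U j L y)).trace) = fun _ => 0 := by
        funext U; simp [Matrix.trace]
      rw [this]; simp [wilsonExpectation]
    rw [h0, norm_zero]
    simp
  · have hN2 : (0 : ℝ) < ((N : ℕ) : ℝ) ^ 2 := by positivity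
    by_cases hE0 : E = 0
    · rw [hE0, norm_zero]
      have h := abs_wilsonExpectation_polyakovPairObs_le_centre ρ hρ hρu hzc hz2 hρz hβ j x y
        (c := 0) (by simp)
      exact mul_nonneg hN2.le ((abs_nonneg _).trans h)
    · -- the optimal phase `c = conj E / ‖E‖`
      set c : ℂ := conj E / (‖E‖ : ℂ) with hc
      have hEn : 0 < ‖E‖ := norm_pos_iff.2 hE0
      have hc1 : ‖c‖ ≤ 1 := by
        rw [hc, norm_div, Complex.norm_conj, Complex.norm_real, Real.norm_eq_abs, abs_of_pos hEn,
          div_self hEn.ne']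
      have hre : (c * E).re = ‖E‖ := by
        rw [hc, div_mul_eq_mul_div, Complex.conj_mul' E]
        rw [show ((‖E‖ : ℂ) ^ 2 / (‖E‖ : ℂ)) = (‖E‖ : ℂ) by
          rw [sq, mul_div_assoc, div_self (Complex.ofReal_ne_zero.2 hEn.ne'), mul_one]]
        exact Complex.ofReal_re _
      have h := abs_wilsonExpectation_polyakovPairObs_le_centre ρ hρ hρu hzc hz2 hρz hβ j x y hc1
      rw [wilsonExpectation_polyakovPairObs ρ hρ hρu β j x y c, ← hE, hre, abs_div,
        abs_of_pos hN2, abs_of_pos hEn, div_le_iff₀ hN2] at h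
      linarith [mul_comm W (((N : ℕ) : ℝ) ^ 2)]

end Domination

/-! ### §4 Instances: `SU(2)` (coupling `2β`) and `SU(N)`, `N` even (coupling `Nβ`) -/

section Instances

open Tomboulis2007

variable {d L : ℕ} [NeZero L] [Fact (1 < L)]

/-- **`SU(2)`: the finite-temperature static quark–antiquark correlator of `SU(2)` at `β` is
dominated by the `ℤ₂` Polyakov-loop correlator at `2β`**:
`‖⟨tr P_x conj tr P_y⟩_{SU(2),β,L}‖ ≤ 4 ⟨χ(P_x)χ(P_y)⟩_{ℤ₂,2β,L}` (Grosse's coupling `2β`, (4.134)).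
[cite: Grosse1988, §4.2.4 eq. (4.134)] [cite: TomboulisYaffe1985, §II eq. (2.8)] -/
theorem su2_norm_polyakovCorrelator_le_z2 {β : ℝ} (hβ : 0 ≤ β) (j : Fin d) (x y : Site d L) :
    ‖wilsonExpectation (fundamentalRep (Fin 2)) β
        (fun U : GaugeConfig d L (Matrix.specialUnitaryGroup (Fin 2) ℂ) =>
          (fundamentalRep (Fin 2) (lineHolonomy U j L x)).trace *
            conj (fundamentalRep (Fin 2) (lineHolonomy U j L y)).trace)‖ ≤
      4 * wilsonExpectation (L := L) z2Rep (2 * β)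
        (fun σ => z2Character (lineHolonomy σ j L x) * z2Character (lineHolonomy σ j L y)) := by
  have h := norm_polyakovCorrelator_le_centre (d := d) (L := L) (fundamentalRep (Fin 2))
    (continuous_fundamentalRep (Fin 2)) (fun g => (Matrix.mem_specialUnitaryGroup_iff.1 g.2).1)
    (z := negOne) (Subgroup.mem_center_iff.2 fun g => (negOne_mul_comm g).symm) negOne_mul_negOne
    (by rw [fundamentalRep_apply]; rfl) hβ j x y
  norm_num at h
  simpa using h

/-- **`SU(N)`, `N` even, `z = -𝟙`**: `‖⟨tr P_x conj tr P_y⟩_{SU(N),β,L}‖ ≤ N² ⟨χ(P_x)χ(P_y)⟩_{ℤ₂,Nβ,L}`.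
[cite: Grosse1988, §4.2.4 eq. (4.134)] [cite: TomboulisYaffe1985, §II eq. (2.8)] -/
theorem specialUnitaryGroup_norm_polyakovCorrelator_le_z2_of_even {N : ℕ} (hN : Even N) {β : ℝ}
    (hβ : 0 ≤ β) (j : Fin d) (x y : Site d L) :
    ‖wilsonExpectation (fundamentalRep (Fin N)) β
        (fun U : GaugeConfig d L (Matrix.specialUnitaryGroup (Fin N) ℂ) =>
          (fundamentalRep (Fin N) (lineHolonomy U j L x)).trace *
            conj (fundamentalRep (Fin N) (lineHolonomy U j L y)).trace)‖ ≤
      (N : ℝ) ^ 2 * wilsonExpectation (L := L) z2Rep ((N : ℝ) * β)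
        (fun σ => z2Character (lineHolonomy σ j L x) * z2Character (lineHolonomy σ j L y)) :=
  norm_polyakovCorrelator_le_centre (d := d) (L := L) (fundamentalRep (Fin N))
    (continuous_fundamentalRep (Fin N)) (fun g => (Matrix.mem_specialUnitaryGroup_iff.1 g.2).1)
    (negOneSU_mem_center hN) (negOneSU_mul_negOneSU hN) (by rw [fundamentalRep_apply]; rfl) hβ j x y

end Instances

end Literature.MathematicalPhysics.QuantumFieldTheory
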